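import Summits.ValiantsHypothesis.ValiantsHypothesis.Theorems.LacunarySymmetroidMatrixDescartesCensusLaguerreSum
import Summits.ValiantsHypothesis.ValiantsHypothesis.Theorems.LacunarySymmetroidMatrixDescartesCensusPivotTwoDescartes

/-!
# `MatrixDescartes` census — sign-variation tools: the TWO-ENDED Descartes budget and the NON-POSITIVE WINDOW lemma

HONEST FRAMING.  Object-search cell `pub-symmetroid`, seat `val-sym-mdr-p1` (generation 13); helper file `--supports` the crux item
stmt-ValiantsHypothesis-18050 (`Theses.LacunarySymmetroid.MatrixDescartes`, OPEN, on HOLD) with NO closure claim.  Kernel lemmas about ONE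
arbitrary real polynomial, used by the companion `…PivotTwoDirectionsBlockLawAll` (the BLOCK `(2,2)` LAW for every exponent
configuration) and re-usable wherever a Descartes count has to be lowered by the position of the negative coefficients rather than by
their number alone.  Nothing here bears on `ζ_sym`, `DoorA26` / `DoorA34`, the crux, or `VP ≠ VNP`.

CONTENTS (`Var` = Mathlib's `Polynomial.signVariations`, `negSupp P` = the tree's set of degrees with negative coefficient,
`…Pivot.TwoDescartes.negSupp`).
* `trailingCoeff_eraseLead` — erasing the leading term of a polynomial with at least two terms keeps the trailing coefficient;
* **`signVariations_two_ended_le`** — `Var(P) + [lead P < 0] + [trail P < 0] ≤ 2 · #negSupp P` (the tree had the one-ended form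
  `TwoDescartes.signVariations_add_le_two_mul_card_negSupp`; the sign blocks alternate, so a negative block at EITHER end saves one);
* `leadingCoeff_add_X_pow_mul`, `trailingCoeff_add_X_pow_mul` — the leading / trailing coefficient of `A + X^k·B` with `natDegree A < k`;
* **`signVariations_window_two_ended`** — the WINDOW LEMMA: if all coefficients of `f` on a degree window `[a, b]` are `≤ 0` and every
  negative coefficient outside the window has its degree in `T`, then `Var(f) + [lead f < 0] + [trail f < 0] ≤ 2·#T + 2`.  Proof: chop
  `f = L + X^a (M + X^{b+1−a} U)` into the coefficients below `a`, on the window, and above `b` (`Census.coeff_sum_C_mul_X_pow`); the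
  window block has `Var(M) = 0` (`Literature…Descartes.signVariations_eq_zero_of_coeff_nonpos`), the two junctions cost at most one each
  (the tree's splitting inequality `Census.signVariations_add_X_pow_mul_le`), and the outer blocks obey the two-ended budget with
  `#negSupp L + #negSupp U ≤ #T`.  (The one-ended version `Var ≤ 2·#T + 2` is in `…PivotRankOneReduction`, same generation.)

[folklore] Descartes sign-pattern bookkeeping; Mathlib's `eraseLead` recursion `signVariations_eq_eraseLead_add_ite`; tree lemmas named
above.  No definitions, no named facts.
-/

-- `Summit.ValiantsHypothesis.ValiantsHypothesis.…` repeats a component by the D-0017 layout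
-- (single-conjunct summit), which the `dupNamespace` linter flags; the name is mandated.
set_option linter.dupNamespace false

namespace Summit.ValiantsHypothesis.ValiantsHypothesis.Theorems.LacunarySymmetroidMatrixDescartes.Census

open Polynomial Finset
open scoped BigOperators

/-! ## 1. A two-ended Descartes budget: `Var(P) + [lead P < 0] + [trail P < 0] ≤ 2 · #negSupp P` -/

/-- Erasing the leading term of a polynomial with at least two terms does not change its trailing coefficient. [folklore] -/
theorem trailingCoeff_eraseLead (P : ℝ[X]) (h : P.eraseLead ≠ 0) : P.eraseLead.trailingCoeff = P.trailingCoeff := by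
  have hP : P ≠ 0 := fun h0 => h (by rw [h0, eraseLead_zero])
  have hne : P.natTrailingDegree ≠ P.natDegree := by
    intro heq
    apply h
    -- `P` is a monomial
    have hmono : P = C P.leadingCoeff * X ^ P.natDegree := by
      ext m
      rw [coeff_C_mul_X_pow]
      split_ifs with hm
      · rw [hm]; rfl
      · rcases lt_or_gt_of_ne hm with h1 | h1
        · exact coeff_eq_zero_of_lt_natTrailingDegree (by rw [heq]; exact h1)
        · exact coeff_eq_zero_of_natDegree_lt h1
    rw [hmono, eraseLead_C_mul_X_pow]
  have hcoef : P.eraseLead.coeff P.natTrailingDegree = P.coeff P.natTrailingDegree := eraseLead_coeff_of_ne _ hne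
  have hnz : P.eraseLead.coeff P.natTrailingDegree ≠ 0 := by
    rw [hcoef]; exact mt trailingCoeff_eq_zero.mp hP
  have h1 : P.eraseLead.natTrailingDegree ≤ P.natTrailingDegree := natTrailingDegree_le_of_ne_zero hnz
  have h2 : P.natTrailingDegree ≤ P.eraseLead.natTrailingDegree := by
    refine le_natTrailingDegree h fun m hm => ?_
    have hm' : m ≠ P.natDegree := by
      have := natTrailingDegree_le_natDegree P
      omega
    rw [eraseLead_coeff_of_ne _ hm']
    exact coeff_eq_zero_of_lt_natTrailingDegree hm
  have h3 : P.eraseLead.natTrailingDegree = P.natTrailingDegree := le_antisymm h1 h2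
  change P.eraseLead.coeff P.eraseLead.natTrailingDegree = P.coeff P.natTrailingDegree
  rw [h3, hcoef]

/-- **Two-ended budget**: `Var(P) + [leadingCoeff P < 0] + [trailingCoeff P < 0] ≤ 2 · #negSupp P` (the sign blocks alternate, so
a negative block at either END saves one variation). [folklore] -/
theorem signVariations_two_ended_le (P : ℝ[X]) :
    P.signVariations + (if P.leadingCoeff < 0 then 1 else 0) + (if P.trailingCoeff < 0 then 1 else 0)
      ≤ 2 * (Pivot.TwoDescartes.negSupp P).card := by
  suffices h : ∀ N : ℕ, ∀ P : ℝ[X], P.support.card ≤ N →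
      P.signVariations + (if P.leadingCoeff < 0 then 1 else 0) + (if P.trailingCoeff < 0 then 1 else 0)
        ≤ 2 * (Pivot.TwoDescartes.negSupp P).card from h _ P le_rfl
  intro N
  induction N with
  | zero =>
    intro P hP
    have hP0 : P = 0 := by
      have : P.support = ∅ := Finset.card_eq_zero.mp (Nat.le_zero.mp hP)
      exact Polynomial.support_eq_empty.mp this
    subst hP0
    simp
  | succ N ih =>
    intro P hP
    by_cases hP0 : P = 0
    · subst hP0; simp
    by_cases hE : P.eraseLead = 0
    · -- `P` is a monomial `C c * X^n`
      have hmono : P = C P.leadingCoeff * X ^ P.natDegree := by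
        have := eraseLead_add_C_mul_X_pow P
        rw [hE, zero_add] at this
        exact this.symm
      have hc : P.leadingCoeff ≠ 0 := fun h => hP0 (leadingCoeff_eq_zero.mp h)
      set c := P.leadingCoeff with hcdef
      set n := P.natDegree with hndef
      have hV : P.signVariations = 0 := by
        rw [hmono, C_mul_X_pow_eq_monomial, signVariations_monomial]
      have htr : P.trailingCoeff = c := by
        have h1 : P.natTrailingDegree = n := by
          rw [hmono, C_mul_X_pow_eq_monomial, natTrailingDegree_monomial hc]
        change P.coeff P.natTrailingDegree = c
        rw [h1, hmono, coeff_C_mul_X_pow, if_pos rfl]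
      have hneg : (Pivot.TwoDescartes.negSupp P).card = if c < 0 then 1 else 0 := by
        have hs : P.support = {n} := by rw [hmono]; exact support_C_mul_X_pow n hc
        unfold Pivot.TwoDescartes.negSupp
        rw [hs]
        have hcn : P.coeff n = c := by rw [hmono, coeff_C_mul_X_pow, if_pos rfl]
        split_ifs with hlt
        · rw [Finset.filter_singleton, if_pos (by rwa [hcn]), Finset.card_singleton]
        · rw [Finset.filter_singleton, if_neg (by rwa [hcn]), Finset.card_empty]
      rw [hV, htr, hneg]
      split_ifs <;> omega
    · have hlt := Polynomial.eraseLead_support_card_lt hP0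
      have ihP := ih P.eraseLead (by omega)
      have hcount := Pivot.TwoDescartes.card_negSupp_eraseLead_add P hP0
      rw [trailingCoeff_eraseLead P hE] at ihP
      rw [Polynomial.signVariations_eq_eraseLead_add_ite hP0]
      have hlc : P.leadingCoeff ≠ 0 := fun h => hP0 (Polynomial.leadingCoeff_eq_zero.mp h)
      have key : SignType.sign P.leadingCoeff = -SignType.sign P.eraseLead.leadingCoeff →
          P.leadingCoeff < 0 ∨ P.eraseLead.leadingCoeff < 0 := by
        intro hs
        rcases lt_or_gt_of_ne hlc with h | h
        · exact Or.inl h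
        · right
          rw [sign_pos h] at hs
          rcases lt_trichotomy P.eraseLead.leadingCoeff 0 with h' | h' | h'
          · exact h'
          · rw [h', sign_zero] at hs; exact absurd hs (by decide)
          · rw [sign_pos h'] at hs; exact absurd hs (by decide)
      by_cases ht : P.trailingCoeff < 0
      · rw [if_pos ht] at ihP ⊢
        by_cases hs : SignType.sign P.leadingCoeff = -SignType.sign P.eraseLead.leadingCoeff
        · rw [if_pos hs]
          rcases key hs with h | h
          · rw [if_pos h] at hcount ⊢
            by_cases h' : P.eraseLead.leadingCoeff < 0
            · rw [if_pos h'] at ihP; omega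
            · rw [if_neg h'] at ihP; omega
          · rw [if_pos h] at ihP
            by_cases h' : P.leadingCoeff < 0
            · rw [if_pos h'] at hcount ⊢; omega
            · rw [if_neg h'] at hcount ⊢; omega
        · rw [if_neg hs]
          by_cases h' : P.leadingCoeff < 0
          · rw [if_pos h'] at hcount ⊢
            by_cases h'' : P.eraseLead.leadingCoeff < 0
            · rw [if_pos h''] at ihP; omega
            · rw [if_neg h''] at ihP; omega
          · rw [if_neg h'] at hcount ⊢
            by_cases h'' : P.eraseLead.leadingCoeff < 0
            · rw [if_pos h''] at ihP; omega
            · rw [if_neg h''] at ihP; omega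
      · rw [if_neg ht] at ihP ⊢
        by_cases hs : SignType.sign P.leadingCoeff = -SignType.sign P.eraseLead.leadingCoeff
        · rw [if_pos hs]
          rcases key hs with h | h
          · rw [if_pos h] at hcount ⊢
            by_cases h' : P.eraseLead.leadingCoeff < 0
            · rw [if_pos h'] at ihP; omega
            · rw [if_neg h'] at ihP; omega
          · rw [if_pos h] at ihP
            by_cases h' : P.leadingCoeff < 0
            · rw [if_pos h'] at hcount ⊢; omega
            · rw [if_neg h'] at hcount ⊢; omega
        · rw [if_neg hs]
          by_cases h' : P.leadingCoeff < 0
          · rw [if_pos h'] at hcount ⊢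
            by_cases h'' : P.eraseLead.leadingCoeff < 0
            · rw [if_pos h''] at ihP; omega
            · rw [if_neg h''] at ihP; omega
          · rw [if_neg h'] at hcount ⊢
            by_cases h'' : P.eraseLead.leadingCoeff < 0
            · rw [if_pos h''] at ihP; omega
            · rw [if_neg h''] at ihP; omega

/-! ## 2. A two-ended window lemma -/

/-- Leading coefficient of `A + X^k·B` when `natDegree A < k` and `B ≠ 0`. [folklore] -/
theorem leadingCoeff_add_X_pow_mul (A B : ℝ[X]) {k : ℕ} (hA : A.natDegree < k) (hB : B ≠ 0) :
    (A + X ^ k * B).leadingCoeff = B.leadingCoeff := by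
  have hXB : X ^ k * B ≠ 0 := mul_ne_zero (pow_ne_zero _ X_ne_zero) hB
  have hdeg : (X ^ k * B).natDegree = k + B.natDegree := by
    rw [natDegree_mul (pow_ne_zero _ X_ne_zero) hB, natDegree_X_pow]
  by_cases hA0 : A = 0
  · rw [hA0, zero_add, mul_comm, leadingCoeff_mul_X_pow]
  have hlt : A.degree < (X ^ k * B).degree := by
    rw [degree_eq_natDegree hA0, degree_eq_natDegree hXB, hdeg]
    exact_mod_cast (show A.natDegree < k + B.natDegree by omega)
  rw [leadingCoeff_add_of_degree_lt hlt, mul_comm, leadingCoeff_mul_X_pow]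

/-- Trailing coefficient of `A + X^k·B` when `A ≠ 0` and `natDegree A < k`. [folklore] -/
theorem trailingCoeff_add_X_pow_mul (A B : ℝ[X]) {k : ℕ} (hA : A ≠ 0) (hAk : A.natDegree < k) :
    (A + X ^ k * B).trailingCoeff = A.trailingCoeff := by
  have hlow : ∀ m, m < k → (A + X ^ k * B).coeff m = A.coeff m := fun m hm => by
    rw [coeff_add, coeff_X_pow_mul', if_neg (by omega), add_zero]
  have htA : A.natTrailingDegree < k := lt_of_le_of_lt (natTrailingDegree_le_natDegree A) hAk
  have hnz : (A + X ^ k * B).coeff A.natTrailingDegree ≠ 0 := by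
    rw [hlow _ htA]; exact mt trailingCoeff_eq_zero.mp hA
  have hne : A + X ^ k * B ≠ 0 := fun h0 => hnz (by rw [h0, coeff_zero])
  have h1 : (A + X ^ k * B).natTrailingDegree ≤ A.natTrailingDegree := natTrailingDegree_le_of_ne_zero hnz
  have h2 : A.natTrailingDegree ≤ (A + X ^ k * B).natTrailingDegree := by
    refine le_natTrailingDegree hne fun m hm => ?_
    rw [hlow m (by omega)]
    exact coeff_eq_zero_of_lt_natTrailingDegree hm
  change (A + X ^ k * B).coeff (A + X ^ k * B).natTrailingDegree = A.coeff A.natTrailingDegree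
  rw [le_antisymm h1 h2, hlow _ htA]

/-- **Two-ended window lemma.**  If the coefficients of `f` on the degree window `[a, b]` are `≤ 0` and every negative coefficient
outside the window sits at a degree in `T`, then `Var(f) + [lead f < 0] + [trail f < 0] ≤ 2·#T + 2` (block chopping
`f = L + X^a (M + X^{b+1−a} U)` with `Var(M) = 0`, the tree's splitting inequality for the two junctions, and the two-ended budget for
`L` and `U`). [folklore] -/
theorem signVariations_window_two_ended (f : ℝ[X]) (a b : ℕ) (hab : a ≤ b)
    (hwin : ∀ m, a ≤ m → m ≤ b → f.coeff m ≤ 0) (T : Finset ℕ)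
    (hT : ∀ m, f.coeff m < 0 → (m < a ∨ b < m) → m ∈ T) :
    f.signVariations + (if f.leadingCoeff < 0 then 1 else 0) + (if f.trailingCoeff < 0 then 1 else 0)
      ≤ 2 * T.card + 2 := by
  classical
  set N := f.natDegree + 1 with hN
  set L : ℝ[X] := ∑ m ∈ range a, C (f.coeff m) * X ^ m with hL
  set M : ℝ[X] := ∑ m ∈ range (b + 1 - a), C (f.coeff (a + m)) * X ^ m with hM
  set U : ℝ[X] := ∑ m ∈ range N, C (f.coeff (b + 1 + m)) * X ^ m with hU
  have hLc : ∀ i, L.coeff i = if i < a then f.coeff i else 0 := fun i => by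
    rw [hL, coeff_sum_C_mul_X_pow]
  have hMc : ∀ i, M.coeff i = if i < b + 1 - a then f.coeff (a + i) else 0 := fun i => by
    rw [hM, coeff_sum_C_mul_X_pow]
  have hUc : ∀ i, U.coeff i = if i < N then f.coeff (b + 1 + i) else 0 := fun i => by
    rw [hU, coeff_sum_C_mul_X_pow]
  have hUc' : ∀ i, U.coeff i = f.coeff (b + 1 + i) := fun i => by
    rw [hUc]
    split_ifs with h
    · rfl
    · rw [coeff_eq_zero_of_natDegree_lt (by omega)]
  have hf : f = L + X ^ a * (M + X ^ (b + 1 - a) * U) := by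
    ext i
    rw [coeff_add, coeff_X_pow_mul', coeff_add, coeff_X_pow_mul', hLc, hMc, hUc']
    by_cases h1 : i < a
    · rw [if_pos h1, if_neg (by omega), add_zero]
    rw [if_neg h1, zero_add, if_pos (by omega)]
    by_cases h2 : i - a < b + 1 - a
    · rw [if_pos h2, if_neg (by omega), add_zero]
      congr 1; omega
    · rw [if_neg h2, zero_add, if_pos (by omega)]
      congr 1; omega
  have hVM : M.signVariations = 0 := by
    refine Literature.Algebra.Polynomial.Descartes.signVariations_eq_zero_of_coeff_nonpos fun n => ?_
    rw [hMc]
    split_ifs with h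
    · exact hwin _ (by omega) (by omega)
    · exact le_rfl
  have hMcoef_nonpos : ∀ n, M.coeff n ≤ 0 := fun n => by
    rw [hMc]
    split_ifs with h
    · exact hwin _ (by omega) (by omega)
    · exact le_rfl
  have hdegM : M.natDegree < b + 1 - a := by
    have h1 : M.natDegree ≤ b - a := by
      rw [hM]
      refine natDegree_sum_le_of_forall_le _ _ fun i hi => ?_
      have := Finset.mem_range.mp hi
      exact (natDegree_C_mul_X_pow_le _ _).trans (by omega)
    omega
  have hnegL : ∀ n ∈ Pivot.TwoDescartes.negSupp L, n ∈ T ∧ n < a := by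
    intro n hn
    simp only [Pivot.TwoDescartes.negSupp, Finset.mem_filter] at hn
    have h := hn.2
    rw [hLc] at h
    split_ifs at h with h1
    · exact ⟨hT n h (Or.inl h1), h1⟩
    · exact absurd h (lt_irrefl 0)
  have hnegU : ∀ n ∈ Pivot.TwoDescartes.negSupp U, b + 1 + n ∈ T := by
    intro n hn
    simp only [Pivot.TwoDescartes.negSupp, Finset.mem_filter] at hn
    have h := hn.2
    rw [hUc'] at h
    exact hT _ h (Or.inr (by omega))
  have hcard : (Pivot.TwoDescartes.negSupp L).card + (Pivot.TwoDescartes.negSupp U).card ≤ T.card := by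
    have hinj : Function.Injective (fun n : ℕ => b + 1 + n) := fun x y hxy => by simpa using hxy
    rw [← Finset.card_image_of_injective (Pivot.TwoDescartes.negSupp U) hinj]
    rw [← Finset.card_union_of_disjoint]
    · refine Finset.card_le_card fun n hn => ?_
      rcases Finset.mem_union.mp hn with h | h
      · exact (hnegL n h).1
      · obtain ⟨k, hk, rfl⟩ := Finset.mem_image.mp h
        exact hnegU k hk
    · refine Finset.disjoint_left.mpr fun n hnL hnU => ?_
      obtain ⟨k, _, rfl⟩ := Finset.mem_image.mp hnU
      have := (hnegL _ hnL).2
      omega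
  have hVL := signVariations_two_ended_le L
  have hVU := signVariations_two_ended_le U
  -- the upper part `M + X^{b+1-a} U`: variations and leading sign against the budget of `U`
  have hupper : (M + X ^ (b + 1 - a) * U).signVariations
      + (if (M + X ^ (b + 1 - a) * U).leadingCoeff < 0 then 1 else 0) ≤ 2 * (Pivot.TwoDescartes.negSupp U).card + 1 := by
    by_cases hU0 : U = 0
    · have hRM : M + X ^ (b + 1 - a) * U = M := by rw [hU0, mul_zero, add_zero]
      rw [hRM, hVM]
      split_ifs <;> omega
    · have hVR := signVariations_add_X_pow_mul_le M U hdegM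
      rw [hVM] at hVR
      rw [leadingCoeff_add_X_pow_mul M U hdegM hU0]
      split_ifs at hVU ⊢ <;> omega
  by_cases ha : a = 0
  · -- no lower block: `f = M + X^{b+1} U`
    have hL0 : L = 0 := by rw [hL, ha, Finset.range_zero, Finset.sum_empty]
    have hXa : (X : ℝ[X]) ^ a = 1 := by rw [ha, pow_zero]
    have hfR : f = M + X ^ (b + 1 - a) * U := by rw [hf, hL0, zero_add, hXa, one_mul]
    have ht : (if (M + X ^ (b + 1 - a) * U).trailingCoeff < 0 then 1 else 0) ≤ 1 := by split_ifs <;> omega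
    rw [hfR]
    omega
  have hdegL : L.natDegree < a := by
    have h1 : L.natDegree ≤ a - 1 := by
      rw [hL]
      refine natDegree_sum_le_of_forall_le _ _ fun i hi => ?_
      have := Finset.mem_range.mp hi
      exact (natDegree_C_mul_X_pow_le _ _).trans (by omega)
    omega
  by_cases hL0 : L = 0
  · -- lower block vanishes: `f = X^a (M + X^{b+1-a} U)`, one junction only
    have hfR : f = X ^ a * (M + X ^ (b + 1 - a) * U) := by rw [hf, hL0, zero_add]
    have hVf : f.signVariations = (M + X ^ (b + 1 - a) * U).signVariations := by
      rw [hfR, Literature.Algebra.Polynomial.Descartes.signVariations_X_pow_mul]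
    have hlf : f.leadingCoeff = (M + X ^ (b + 1 - a) * U).leadingCoeff := by
      rw [hfR, mul_comm, leadingCoeff_mul_X_pow]
    have ht : (if f.trailingCoeff < 0 then 1 else 0) ≤ 1 := by split_ifs <;> omega
    rw [hVf, hlf]
    omega
  have htf : f.trailingCoeff = L.trailingCoeff := by
    rw [hf]; exact trailingCoeff_add_X_pow_mul L _ hL0 hdegL
  by_cases hR0 : M + X ^ (b + 1 - a) * U = 0
  · have hfL : f = L := by rw [hf, hR0, mul_zero, add_zero]
    rw [hfL]
    omega
  · have hlf : f.leadingCoeff = (M + X ^ (b + 1 - a) * U).leadingCoeff := by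
      rw [hf]; exact leadingCoeff_add_X_pow_mul L _ hdegL hR0
    have hVf := signVariations_add_X_pow_mul_le L (M + X ^ (b + 1 - a) * U) hdegL
    rw [← hf] at hVf
    rw [hlf, htf]
    split_ifs at hVL hupper ⊢ <;> omega

end Summit.ValiantsHypothesis.ValiantsHypothesis.Theorems.LacunarySymmetroidMatrixDescartes.Census
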